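import Mathlib
import HarnessLib
import Literature.MathematicalPhysics.QuantumFieldTheory.YangMillsOS

/-!
# `CurvatureKernelBound` — brick `CurvatureSwapCovariance` of lead c10's swap-mirror programme toward `Stub.FiniteCouplingStrongSubextensive`
# (crux stmt-QuantumFields-11687, line `coupling-trichotomy`, skeleton v9)

Exact covariance of the lattice curvature observable (the Wilson action density at the origin,
`actionDensity ρ U = ∑_{k<l} Re tr ρ(U_{p_{kl}(0)})`) under the coordinate swap `x_i ↔ x_j` of
`ℤ⁴`, acting on gauge configurations by `(ΘU)(x, k) = U (x ∘ swap i j, swap i j k)`: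

* `plaquetteHolonomyZd (ΘU) y k l = plaquetteHolonomyZd U (y ∘ swap) (swap k) (swap l)` exactly
  in `G` (the shifted base point `(y + e_k) ∘ swap = y ∘ swap + e_{swap k}`);
* for a unitary representation `Re tr ρ(U_{p_{lk}}) = Re tr ρ(U_{p_{kl}})` (the reversed plaquette
  carries the inverse holonomy and `ρ(h⁻¹) = ρ(h)ᴴ`), so the six-plane sum is invariant under the
  induced permutation of planes;
* hence `actionDensity ρ (τ_{x} Θ U) = actionDensity ρ (τ_{x ∘ swap} U)` (`CurvatureSwapCovariance`)
  and, reindexing the smearing sum over the swap-invariant box, the smeared fields built from test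
  functions related by the swap agree (`SmearedCurvatureSwapCovariance`).
-/

noncomputable section

open scoped BigOperators Topology SchwartzMap
open MeasureTheory Filter Set
open Literature.MathematicalPhysics.QuantumLattice Literature.MathematicalPhysics.QuantumFieldTheory
  Literature.Probability.LatticeModels

namespace Summit.QuantumFields.YangMills.Theorems.CurvatureKernel

/-! ### Combinatorics of the coordinate swap on `ℤ⁴` -/

/-- Shifting the base point by `e_k` and then swapping coordinates is swapping and then shifting by
`e_{swap k}`: `(y + e_k) ∘ swap i j = y ∘ swap i j + e_{swap i j k}`. [folklore] -/
theorem comp_swap_add_single (i j : Fin 4) (y : Literature.Probability.LatticeModels.Site 4)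
    (k : Fin 4) :
    (y + Pi.single k 1) ∘ ⇑(Equiv.swap i j) =
      y ∘ ⇑(Equiv.swap i j) + Pi.single (Equiv.swap i j k) 1 := by
  funext m
  simp only [Function.comp_apply, Pi.add_apply, Pi.single_apply, Equiv.swap_apply_eq_iff]

/-- The coordinate swap is an involution on sites: `(x ∘ swap) ∘ swap = x`. [folklore] -/
theorem comp_swap_comp_swap (i j : Fin 4) (x : Literature.Probability.LatticeModels.Site 4) :
    (x ∘ ⇑(Equiv.swap i j)) ∘ ⇑(Equiv.swap i j) = x := by
  funext m
  simp only [Function.comp_apply, Equiv.swap_apply_self]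

/-- The centred box `{-L, …, L}⁴` is invariant under the coordinate swap. [folklore] -/
theorem comp_swap_mem_box (i j : Fin 4) {L : ℕ} {x : Literature.Probability.LatticeModels.Site 4}
    (hx : x ∈ Literature.Probability.LatticeModels.box 4 L) :
    x ∘ ⇑(Equiv.swap i j) ∈ Literature.Probability.LatticeModels.box 4 L :=
  mem_box.2 fun m => mem_box.1 hx (Equiv.swap i j m)

/-! ### Covariance and symmetry of plaquette holonomies -/

/-- **Exact covariance of the plaquette holonomy under the swap**: the holonomy of the swapped
configuration around the `(k, l)` plaquette at `y` is the holonomy of the original configuration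
around the `(swap k, swap l)` plaquette at `y ∘ swap`. [folklore] -/
theorem plaquetteHolonomyZd_swap {G : Type} [Group G] (i j : Fin 4) (W : LGConfig 4 G)
    (y : Literature.Probability.LatticeModels.Site 4) (k l : Fin 4) :
    plaquetteHolonomyZd (fun e : ZdEdge 4 => W (e.1 ∘ Equiv.swap i j, Equiv.swap i j e.2)) y k l =
      plaquetteHolonomyZd W (y ∘ Equiv.swap i j) (Equiv.swap i j k) (Equiv.swap i j l) := by
  simp only [plaquetteHolonomyZd, comp_swap_add_single]

/-- Reversing the orientation of a plaquette inverts its holonomy: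
`U_{p_{lk}(x)} = (U_{p_{kl}(x)})⁻¹`. [folklore] -/
theorem plaquetteHolonomyZd_rev {d : ℕ} {G : Type} [Group G] (U : LGConfig d G)
    (x : Literature.Probability.LatticeModels.Site d) (k l : Fin d) :
    plaquetteHolonomyZd U x l k = (plaquetteHolonomyZd U x k l)⁻¹ := by
  simp only [plaquetteHolonomyZd, mul_inv_rev, inv_inv, mul_assoc]

/-- A unitary representation sends inverses to adjoints: `ρ(h⁻¹) = ρ(h)ᴴ`. [folklore] -/
theorem rep_inv_eq_star {G : Type} [Group G] {N : ℕ} (ρ : G →* Matrix (Fin N) (Fin N) ℂ)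
    (hρ : ∀ g, ρ g ∈ Matrix.unitaryGroup (Fin N) ℂ) (h : G) : ρ h⁻¹ = star (ρ h) := by
  have h1 : ρ h⁻¹ * ρ h = 1 := by rw [← map_mul, inv_mul_cancel, map_one]
  have h2 : ρ h * star (ρ h) = 1 := Matrix.mem_unitaryGroup_iff.1 (hρ h)
  calc ρ h⁻¹ = ρ h⁻¹ * (ρ h * star (ρ h)) := by rw [h2, mul_one]
    _ = star (ρ h) := by rw [← mul_assoc, h1, one_mul]

/-- For a unitary representation `Re tr ρ(h⁻¹) = Re tr ρ(h)` (`tr ρ(h)ᴴ = conj tr ρ(h)`). [folklore] -/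
theorem re_trace_rep_inv {G : Type} [Group G] {N : ℕ} (ρ : G →* Matrix (Fin N) (Fin N) ℂ)
    (hρ : ∀ g, ρ g ∈ Matrix.unitaryGroup (Fin N) ℂ) (h : G) :
    (ρ h⁻¹).trace.re = (ρ h).trace.re := by
  rw [rep_inv_eq_star ρ hρ h, Matrix.star_eq_conjTranspose, Matrix.trace_conjTranspose]
  exact Complex.conj_re _

/-- **Orientation symmetry of the plaquette observable** for a unitary representation:
`Re tr ρ(U_{p_{kl}(x)}) = Re tr ρ(U_{p_{lk}(x)})`. [folklore] -/
theorem plaquetteObs_symm {d : ℕ} {G : Type} [Group G] {N : ℕ}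
    (ρ : G →* Matrix (Fin N) (Fin N) ℂ) (hρ : ∀ g, ρ g ∈ Matrix.unitaryGroup (Fin N) ℂ)
    (x : Literature.Probability.LatticeModels.Site d) (k l : Fin d) (U : LGConfig d G) :
    plaquetteObs ρ x k l U = plaquetteObs ρ x l k U := by
  unfold plaquetteObs
  rw [plaquetteHolonomyZd_rev U x k l, re_trace_rep_inv ρ hρ]

/-- **Exact covariance of the plaquette observable under the swap**. [folklore] -/
theorem plaquetteObs_swap {G : Type} [Group G] {N : ℕ} (ρ : G →* Matrix (Fin N) (Fin N) ℂ)
    (i j : Fin 4) (W : LGConfig 4 G) (y : Literature.Probability.LatticeModels.Site 4)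
    (k l : Fin 4) :
    plaquetteObs ρ y k l (fun e : ZdEdge 4 => W (e.1 ∘ Equiv.swap i j, Equiv.swap i j e.2)) =
      plaquetteObs ρ (y ∘ Equiv.swap i j) (Equiv.swap i j k) (Equiv.swap i j l) W := by
  unfold plaquetteObs
  rw [plaquetteHolonomyZd_swap]

/-! ### Permutation invariance of the six-plane sum -/

/-- For a symmetric kernel the ordered-pair sum `∑_{k<l} P k l` is half the off-diagonal sum
`∑_{k≠l} P k l`. [folklore] -/
theorem sum_lt_eq_half_sum_ne {d : ℕ} (P : Fin d → Fin d → ℝ) (hP : ∀ k l, P k l = P l k) :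
    (∑ k : Fin d, ∑ l : Fin d, if k < l then P k l else 0) =
      (1 / 2) * ∑ k : Fin d, ∑ l : Fin d, if k ≠ l then P k l else 0 := by
  have hsplit : (∑ k : Fin d, ∑ l : Fin d, if k ≠ l then P k l else 0) =
      (∑ k : Fin d, ∑ l : Fin d, if k < l then P k l else 0) +
        ∑ k : Fin d, ∑ l : Fin d, if l < k then P k l else 0 := by
    rw [← Finset.sum_add_distrib]
    refine Finset.sum_congr rfl fun k _ => ?_
    rw [← Finset.sum_add_distrib]
    refine Finset.sum_congr rfl fun l _ => ?_
    rcases lt_trichotomy k l with h | h | h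
    · rw [if_pos h.ne, if_pos h, if_neg (lt_asymm h), add_zero]
    · subst h
      rw [if_neg (fun h => h rfl), if_neg (lt_irrefl _), add_zero]
    · rw [if_pos h.ne', if_neg (lt_asymm h), if_pos h, zero_add]
  have hswap : (∑ k : Fin d, ∑ l : Fin d, if l < k then P k l else 0) =
      ∑ k : Fin d, ∑ l : Fin d, if k < l then P k l else 0 :=
    calc (∑ k : Fin d, ∑ l : Fin d, if l < k then P k l else 0)
        = ∑ l : Fin d, ∑ k : Fin d, if l < k then P k l else 0 := Finset.sum_comm
      _ = ∑ l : Fin d, ∑ k : Fin d, if l < k then P l k else 0 :=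
          Finset.sum_congr rfl fun l _ => Finset.sum_congr rfl fun k _ => by rw [hP]
  rw [hsplit, hswap]
  ring

/-- Reindexing the off-diagonal double sum by a permutation of the indices. [folklore] -/
theorem sum_ne_perm {d : ℕ} (P : Fin d → Fin d → ℝ) (σ : Equiv.Perm (Fin d)) :
    (∑ k : Fin d, ∑ l : Fin d, if k ≠ l then P (σ k) (σ l) else 0) =
      ∑ k : Fin d, ∑ l : Fin d, if k ≠ l then P k l else 0 :=
  calc (∑ k : Fin d, ∑ l : Fin d, if k ≠ l then P (σ k) (σ l) else 0)
      = ∑ k : Fin d, ∑ l : Fin d, if σ k ≠ σ l then P (σ k) (σ l) else 0 := by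
        simp only [ne_eq, σ.injective.eq_iff]
    _ = ∑ k : Fin d, ∑ l : Fin d, if σ k ≠ l then P (σ k) l else 0 :=
        Finset.sum_congr rfl fun k _ =>
          Equiv.sum_comp σ (fun l => if σ k ≠ l then P (σ k) l else 0)
    _ = ∑ k : Fin d, ∑ l : Fin d, if k ≠ l then P k l else 0 :=
        Equiv.sum_comp σ (fun k => ∑ l, if k ≠ l then P k l else 0)

/-- **Permutation invariance of the ordered-pair sum of a symmetric kernel**:
`∑_{k<l} P (σ k) (σ l) = ∑_{k<l} P k l`. [folklore] -/
theorem sum_lt_perm {d : ℕ} (P : Fin d → Fin d → ℝ) (hP : ∀ k l, P k l = P l k)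
    (σ : Equiv.Perm (Fin d)) :
    (∑ k : Fin d, ∑ l : Fin d, if k < l then P (σ k) (σ l) else 0) =
      ∑ k : Fin d, ∑ l : Fin d, if k < l then P k l else 0 :=
  calc (∑ k : Fin d, ∑ l : Fin d, if k < l then P (σ k) (σ l) else 0)
      = (1 / 2) * ∑ k : Fin d, ∑ l : Fin d, if k ≠ l then P (σ k) (σ l) else 0 :=
        sum_lt_eq_half_sum_ne (fun k l => P (σ k) (σ l)) fun _ _ => hP _ _
    _ = (1 / 2) * ∑ k : Fin d, ∑ l : Fin d, if k ≠ l then P k l else 0 := by rw [sum_ne_perm P σ]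
    _ = ∑ k : Fin d, ∑ l : Fin d, if k < l then P k l else 0 := (sum_lt_eq_half_sum_ne P hP).symm

/-! ### Swap invariance of the action density -/

/-- **Swap invariance of the Wilson action density at the origin** for a unitary representation:
`actionDensity ρ (ΘW) = actionDensity ρ W` (the swap fixes the origin and permutes the six
coordinate planes, reversing the orientation of some; orientation reversal is invisible to
`Re tr ρ`). [folklore] -/
theorem actionDensity_swap {G : Type} [Group G] {N : ℕ} (ρ : G →* Matrix (Fin N) (Fin N) ℂ)
    (hρ : ∀ g, ρ g ∈ Matrix.unitaryGroup (Fin N) ℂ) (i j : Fin 4) (W : LGConfig 4 G) :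
    actionDensity ρ (fun e : ZdEdge 4 => W (e.1 ∘ Equiv.swap i j, Equiv.swap i j e.2)) =
      actionDensity ρ W := by
  unfold actionDensity
  simp only [plaquetteObs_swap ρ i j W, Pi.zero_comp]
  exact sum_lt_perm (fun k l => plaquetteObs ρ 0 k l W) (fun k l => plaquetteObs_symm ρ hρ 0 k l W)
    (Equiv.swap i j)

/-- **Exact covariance of the lattice curvature observable under the diagonal mirror / coordinate
swap `x_i ↔ x_j` of `ℤ⁴`**: translating the swapped configuration by `x` and evaluating the action
density is evaluating it on the original configuration translated by `x ∘ swap i j`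
(REGISTERED signature — do not change). [folklore] -/
theorem CurvatureSwapCovariance : ∀ {G : Type} [Group G] [MeasurableSpace G] {N : ℕ} (ρ : G →* Matrix (Fin N) (Fin N) ℂ), (∀ g, ρ g ∈ Matrix.unitaryGroup (Fin N) ℂ) → ∀ (i j : Fin 4) (U : Literature.MathematicalPhysics.QuantumLattice.LGConfig 4 G) (x : Literature.Probability.LatticeModels.Site 4), Literature.MathematicalPhysics.QuantumFieldTheory.actionDensity ρ (Literature.MathematicalPhysics.QuantumLattice.configShift (-x) (fun e : Literature.MathematicalPhysics.QuantumLattice.ZdEdge 4 => U (e.1 ∘ Equiv.swap i j, Equiv.swap i j e.2))) = Literature.MathematicalPhysics.QuantumFieldTheory.actionDensity ρ (Literature.MathematicalPhysics.QuantumLattice.configShift (-(x ∘ Equiv.swap i j)) U) := by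
  intro G _ _ N ρ hρ i j U x
  have hconf : Literature.MathematicalPhysics.QuantumLattice.configShift (-x)
        (fun e : ZdEdge 4 => U (e.1 ∘ Equiv.swap i j, Equiv.swap i j e.2)) =
      fun e : ZdEdge 4 =>
        (Literature.MathematicalPhysics.QuantumLattice.configShift (-(x ∘ Equiv.swap i j)) U)
          (e.1 ∘ Equiv.swap i j, Equiv.swap i j e.2) := by
    funext e
    simp only [Literature.MathematicalPhysics.QuantumLattice.configShift_apply]
    rfl
  rw [hconf]
  exact actionDensity_swap ρ hρ i j _

/-- **Swap covariance of the smeared curvature field**: if the test functions `f, g` are related on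
the rescaled lattice by `g (a x) = f (a (x ∘ swap i j))`, then smearing the action density of the
swapped configuration against `f` over the (swap-invariant) box `{-L, …, L}⁴` equals smearing the
action density of the original configuration against `g` (REGISTERED signature — do not change). [folklore] -/
theorem SmearedCurvatureSwapCovariance : ∀ {G : Type} [Group G] [MeasurableSpace G] {N : ℕ} (ρ : G →* Matrix (Fin N) (Fin N) ℂ), (∀ g, ρ g ∈ Matrix.unitaryGroup (Fin N) ℂ) → ∀ (i j : Fin 4) (L : ℕ) (a c m : ℝ) (f g : 𝓢(EuclideanSpace ℝ (Fin 4), ℝ)), (∀ x : Literature.Probability.LatticeModels.Site 4, g (a • Literature.MathematicalPhysics.QuantumLattice.siteToE x) = f (a • Literature.MathematicalPhysics.QuantumLattice.siteToE (x ∘ Equiv.swap i j))) → ∀ U : Literature.MathematicalPhysics.QuantumLattice.LGConfig 4 G, Literature.MathematicalPhysics.QuantumFieldTheory.smearedLatticeField (Literature.MathematicalPhysics.QuantumFieldTheory.actionDensity ρ) (Literature.Probability.LatticeModels.box 4 L) a c m f (fun e : Literature.MathematicalPhysics.QuantumLattice.ZdEdge 4 => U (e.1 ∘ Equiv.swap i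 j, Equiv.swap i j e.2)) = Literature.MathematicalPhysics.QuantumFieldTheory.smearedLatticeField (Literature.MathematicalPhysics.QuantumFieldTheory.actionDensity ρ) (Literature.Probability.LatticeModels.box 4 L) a c m g U := by
  intro G _ _ N ρ hρ i j L a c m f g hfg U
  unfold smearedLatticeField
  congr 1
  refine Finset.sum_nbij' (fun x => x ∘ ⇑(Equiv.swap i j)) (fun x => x ∘ ⇑(Equiv.swap i j))
    (fun x hx => comp_swap_mem_box i j hx) (fun x hx => comp_swap_mem_box i j hx)
    (fun x _ => comp_swap_comp_swap i j x) (fun x _ => comp_swap_comp_swap i j x) ?_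
  intro x _
  rw [CurvatureSwapCovariance ρ hρ i j U x, hfg, comp_swap_comp_swap]

end Summit.QuantumFields.YangMills.Theorems.CurvatureKernel

end
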